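import Summits.AtomisticToContinuum.FouriersLaw.Theses.OddSectorIrreversibility

/-!
# Sketch — crux idea `stationary-exceedance-cold-cone` on `ClosedConeSensitivity` (E3),
round 1, ideator 3 (gen 2).  Definitions only (no theorems, no sorry).

Lever: single-time STATIONARITY of the closed flow under the Gibbs weight (Liouville) plus the
Rice / upcrossing inequality turn every "some site near the signal path gets hot at SOME time of the
window" event into a single-time Gibbs tail; on the complement the chain is uniformly cold
(all local energies ≤ 2E_*), the tilted secant/tangent energy obeys a DETERMINISTIC Grönwall
with rate Λ(E_*) ≍ √E_*, and finite kicks are capped off the good event.  Choosing E_* ≍ T log d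
gives the finite-kick L²(Gibbs) cone with window c·d/√log(2+d) and every polynomial tail,
N-uniformly — provable now; E_* ≍ d gives back the attack seat's √d window with exponential tail.

* `StationaryUpcrossingBound` — FIRST LEMMA (abstract, Mathlib-only).
* `siteEnergy`, `siteEnergyDot`, `flowSiteEnergy` — tree-level objects.
* `ClosedFlowEnergyExceedance` — the instance for the pinned chain (needs Liouville + Gibbs local tails).
* `LogLipschitzTiltInequality` — the deterministic engine with general log-Lipschitz (tent) weights.
* `ColdBoxMasterEstimate` — the one-parameter family (E_*) of finite-kick bounds.
* `LogWindowKickCone` (Tier P, typed like the crux) and `LogWindowResampledCone` (card B's object).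
-/

noncomputable section

open MeasureTheory Filter Set
open scoped BigOperators NNReal ENNReal

namespace Summit.AtomisticToContinuum.FouriersLaw.Cruxes.ClosedConeSensitivity.Ideator3g2

open Literature.MathematicalPhysics.KineticTheory.HeatConduction
open Summit.AtomisticToContinuum.FouriersLaw.Theses.OddSectorIrreversibility

/-- **FIRST LEMMA (`StationaryUpcrossingBound`, abstract Rice / upcrossing maximal inequality).**
Let `Φ` be a flow of measurable maps preserving `μ`, `f` an observable that is `C¹` along orbits
with orbital derivative `g` (`d/dt f(Φ_t x) = g(Φ_t x)`). Every upcrossing of the band `[E, 2E]`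
by `t ↦ f(Φ_t x)` forces `∫ |g(Φ_t x)|·1{f(Φ_t x) ∈ [E,2E]} dt ≥ E` on that upcrossing, so
`{sup_{t ≤ τ} f∘Φ_t ≥ 2E} ⊆ {f ≥ E at t = 0} ∪ {≥ 1 upcrossing}` and Markov + Fubini + invariance give
`μ{∃ t ∈ [0,τ] : f(Φ_t x) ≥ 2E} ≤ μ{f ≥ E} + (τ/E)·∫_{E ≤ f ≤ 2E} |g| dμ`:
a CONTINUOUS-TIME exceedance bound paid with SINGLE-TIME quantities only (no mixing, no dynamics). -/
def StationaryUpcrossingBound : Prop :=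
  ∀ (X : Type) [MeasurableSpace X] (μ : Measure X) (Φ : ℝ → X → X) (f g : X → ℝ) (E τ : ℝ),
    0 < E → 0 ≤ τ →
    (∀ t : ℝ, MeasurePreserving (Φ t) μ μ) →
    Measurable f → Measurable g → Measurable (Function.uncurry Φ) →
    (∀ x : X, Φ 0 x = x) →
    (∀ (x : X) (t : ℝ), HasDerivAt (fun s : ℝ => f (Φ s x)) (g (Φ t x)) t) →
      μ {x | ∃ t ∈ Set.Icc (0 : ℝ) τ, 2 * E ≤ f (Φ t x)}
        ≤ μ {x | E ≤ f x} +
          ENNReal.ofReal (τ / E) * ∫⁻ x in {x | E ≤ f x ∧ f x ≤ 2 * E}, ENNReal.ofReal |g x| ∂μ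

section TreeObjects
variable (ω₂ lam β : ℝ) (N : ℕ) (T : ℝ)

/-- Site energy of the pinned chain, bond energies split evenly:
`e_k = p_k²/2 + U(q_k) + ½V(r_{k−1}) + ½V(r_k)` (`U(q) = ω₂q²/2 + lam q⁴/4`, `V(r) = r²/2 + βr⁴/4`). -/
def siteEnergy (x : PhaseSpace N) (k : Fin N) : ℝ :=
  x.2 k ^ 2 / 2 + (ω₂ * x.1 k ^ 2 / 2 + lam * x.1 k ^ 4 / 4) +
    (1 / 2) * ∑ j : Fin N, (if j.val = k.val + 1 ∨ k.val = j.val + 1 then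
      ((x.1 j - x.1 k) ^ 2 / 2 + β * (x.1 j - x.1 k) ^ 4 / 4) else 0)

/-- Orbital derivative of the site energy along the CLOSED flow: `ė_k = j_{k−1} − j_k`
(`j_i = −½(p_i + p_{i+1})V'(r_i)` the tree's `bondCurrent`; `j_{−1} := 0`, `j_{N−1} ≡ 0`). -/
def siteEnergyDot (x : PhaseSpace N) (k : Fin N) : ℝ :=
  (∑ i : Fin N, (if i.val + 1 = k.val then (pinnedChain ω₂ lam β 0).bondCurrent N i x else 0))
    - (pinnedChain ω₂ lam β 0).bondCurrent N k x

/-- `e_k ∘ Φ_t` through the zero-friction kernels (`Φ_t` = the closed Hamiltonian flow; the kernel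
is the Dirac mass at it, Disproof.lean `transitionKernel_zero_friction`). -/
def flowSiteEnergy (t : ℝ) (k : Fin N) (x : PhaseSpace N) : ℝ :=
  ∫ y, siteEnergy ω₂ lam β N y k ∂((pinnedChain ω₂ lam β 0).transitionKernel N T T t.toNNReal x)

/-- Mean-square resampled-kick difference `½ ∫ (g(q,p[b↦p']) − g(q,p))² dN(0,T)(p')` (card B's object). -/
def resampleVar (T' : ℝ≥0) (b : Fin N) (g : PhaseSpace N → ℝ) (x : PhaseSpace N) : ℝ :=
  (1 / 2) * ∫ p', (g (x.1, Function.update x.2 b p') - g x) ^ 2 ∂(ProbabilityTheory.gaussianReal 0 T')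

end TreeObjects

/-- **The instance (`ClosedFlowEnergyExceedance`): continuous-time hot-site exceedance under the
stationary closed flow costs a single-time Gibbs tail.** For the pinned chain and the Gibbs weight
`μ_T = e^{−H/T} dq dp` (mass `Z`), uniformly in `N` and the site `k`:
`μ_T{x : ∃ t ∈ [0,τ], e_k(Φ_t x) ≥ 2E} ≤ C (1 + τ)(1 + E)² e^{−E/T} Z`.
Ingredients: `StationaryUpcrossingBound` + Liouville invariance of `μ_T` under the closed flow
(energy conservation `hamiltonian_detFlow` is in Disproof.lean; volume preservation = support item)
+ N-uniform Gibbs local tails/moments (`|ė_k| ≤ C(e_{k−1}+e_k+e_{k+1})^{5/4}`; 1-D transfer-operator /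
superstability estimate = support item). -/
def ClosedFlowEnergyExceedance : Prop :=
  ∀ ω₂ lam β γ : ℝ, 0 < ω₂ → 0 < lam → 0 < β → 0 < γ → ∀ T : ℝ, 0 < T → ∃ C : ℝ,
    ∀ (N : ℕ) (k : Fin N) (E τ : ℝ), 1 ≤ E → 0 ≤ τ →
      let P := pinnedChain ω₂ lam β γ
      let μT : Measure (PhaseSpace N) :=
        volume.withDensity (fun x : PhaseSpace N => ENNReal.ofReal (Real.exp (-(P.hamiltonian N x) / T)))
      μT {x | ∃ t ∈ Set.Icc (0 : ℝ) τ, 2 * E ≤ flowSiteEnergy ω₂ lam β N T t k x}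
        ≤ ENNReal.ofReal (C * (1 + τ) * (1 + E) ^ 2 * Real.exp (-E / T) *
            ∫ x, Real.exp (-(P.hamiltonian N x) / T) ∂volume)

/-! ### The deterministic engine with general log-Lipschitz weights (tent gauge) -/

/-- Local convex tangent/secant energy at site `k`: `δp_k² + κ_k δq_k² + σ_k (δq_{k+1} − δq_k)²`. -/
def localEnergy (N : ℕ) (κ σ δq δp : Fin N → ℝ) (k : Fin N) : ℝ :=
  δp k ^ 2 + κ k * δq k ^ 2 +
    σ k * ∑ j : Fin N, (if j.val = k.val + 1 then (δq j - δq k) ^ 2 else 0)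

/-- Weighted energy `W_w = Σ_k w_k ε_k` for an arbitrary positive weight `w`. -/
def weightedEnergy (N : ℕ) (w : Fin N → ℝ) (κ σ δq δp : Fin N → ℝ) : ℝ :=
  ∑ k : Fin N, w k * localEnergy N κ σ δq δp k

/-- Local rate `ρ_k = |κ̇_k|/κ_k + |σ̇_k|/σ_k + e^{2θ}(e^{2θ}−1)(√σ_k + √σ_{k−1})` (as in ideator 3's
`TiltInequality`; on a cold box all three are `≤ C(1 + √e_loc)`). -/
def localRate (N : ℕ) (θ : ℝ) (κ σ dκ dσ : Fin N → ℝ) (k : Fin N) : ℝ :=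
  |dκ k| / κ k + |dσ k| / σ k +
    Real.exp (2 * θ) * (Real.exp (2 * θ) - 1) *
      (Real.sqrt (σ k) + ∑ j : Fin N, (if k.val = j.val + 1 then Real.sqrt (σ j) else 0))

/-- **`LogLipschitzTiltInequality` (deterministic, Mathlib-only).** The symplectic Combes–Thomas
Grönwall of ideator 3's `TiltInequality`, for ANY weight that is log-Lipschitz with constant `2θ`
(`w_{k+1} ≤ e^{2θ} w_k`, `w_k ≤ e^{2θ} w_{k+1}`) — in particular the TENT `w_k = e^{2θ min(k, 2L−k)}`
peaked at the readout site, which is what makes the cold-box estimate N-uniform (far sites carry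
weight ≤ 1 and enter only as additive forcing). For positive `C¹` stiffness paths and any `C¹` solution
of the linearised lattice system, `Σ_k w_k ρ_k ε_k ≤ R·W_w` on `[0,τ]` ⟹ `W_w(τ) ≤ W_w(0)·exp ∫₀^τ R`. -/
def LogLipschitzTiltInequality : Prop :=
  ∀ (N : ℕ) (θ : ℝ) (w : Fin N → ℝ) (κ σ dκ dσ δq δp : ℝ → Fin N → ℝ) (τ : ℝ), 0 ≤ θ → 0 ≤ τ →
    (∀ k, 0 < w k) →
    (∀ k j : Fin N, j.val = k.val + 1 → w j ≤ Real.exp (2 * θ) * w k ∧ w k ≤ Real.exp (2 * θ) * w j) →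
    (∀ t k, 0 < κ t k) → (∀ t k, 0 < σ t k) →
    (∀ t k, HasDerivAt (fun s => κ s k) (dκ t k) t) →
    (∀ t k, HasDerivAt (fun s => σ s k) (dσ t k) t) →
    (∀ k, Continuous fun t => dκ t k) → (∀ k, Continuous fun t => dσ t k) →
    (∀ t k, HasDerivAt (fun s => δq s k) (δp t k) t) →
    (∀ t k, HasDerivAt (fun s => δp s k)
        (-(κ t k * δq t k)
          + (∑ j : Fin N, (if j.val = k.val + 1 then σ t k * (δq t j - δq t k) else 0))
          - (∑ j : Fin N, (if k.val = j.val + 1 then σ t j * (δq t k - δq t j) else 0))) t) →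
    ∀ R : ℝ → ℝ, Continuous R →
      (∀ t ∈ Set.Icc (0 : ℝ) τ,
          (∑ k : Fin N, w k * (localRate N θ (κ t) (σ t) (dκ t) (dσ t) k * localEnergy N (κ t) (σ t) (δq t) (δp t) k))
            ≤ R t * weightedEnergy N w (κ t) (σ t) (δq t) (δp t)) →
      weightedEnergy N w (κ τ) (σ τ) (δq τ) (δp τ)
        ≤ weightedEnergy N w (κ 0) (σ 0) (δq 0) (δp 0) * Real.exp (∫ t in (0 : ℝ)..τ, R t)

/-! ### The finite-kick bounds -/

/-- **`ColdBoxMasterEstimate` — the one-parameter family.** For every threshold `E_* ≥ 1` and times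
in the cold window `t ≤ c·d/√E_*`:
`Z⁻¹ ∫ (Δ_s(j_i∘Φ_t))² dμ_T ≤ C·[(2+d)³ (1+t) E_*³ e^{−E_*/(2T)} + E_*³ e^{−θ d}]`
(first term: the bad event "some site of the box `[0,2d]` (or a far site above its growing threshold)
exceeds `2E_*` during `[0,t]`, in either copy" × the cap, by `ClosedFlowEnergyExceedance` and Gibbs
`L⁴` moments along the flow (invariance); second term: the deterministic tent-gauge cone on the good
event, rate `Λ(E_*) = C_θ(1 + √(2E_*))`). `E_* = 2T(m+3) log(2+d)` gives `LogWindowKickCone`;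
`E_* = c' d` gives the √d window with an exponential tail (the attack seat's horizon, re-derived). -/
def ColdBoxMasterEstimate : Prop :=
  ∀ ω₂ lam β γ : ℝ, 0 < ω₂ → 0 < lam → 0 < β → 0 < γ → ∀ T : ℝ, 0 < T → ∃ c θ C : ℝ, 0 < c ∧ 0 < θ ∧
    ∀ (N : ℕ) (i b : Fin N) (t s Es : ℝ), (b.val = 0 ∨ b.val = N - 1) → 0 ≤ t → 0 < s → s ≤ 1 → 1 ≤ Es →
      let P := pinnedChain ω₂ lam β γ
      let P₀ := pinnedChain ω₂ lam β 0
      let μT : Measure (PhaseSpace N) :=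
        volume.withDensity (fun x : PhaseSpace N => ENNReal.ofReal (Real.exp (-(P.hamiltonian N x) / T)))
      let d : ℕ := (if b.val = 0 then i.val else N - 2 - i.val)
      t ≤ c * (d : ℝ) / Real.sqrt Es →
        ∫ x, ((∫ y, P.bondCurrent N i y ∂(P₀.transitionKernel N T T t.toNNReal (x.1, Function.update x.2 b (x.2 b + s))))
              - (∫ y, P.bondCurrent N i y ∂(P₀.transitionKernel N T T t.toNNReal x))) ^ 2 ∂μT
          ≤ C * (((2 : ℝ) + d) ^ 3 * (1 + t) * Es ^ 3 * Real.exp (-Es / (2 * T)) + Es ^ 3 * Real.exp (-(θ * d)))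
              * ∫ x, Real.exp (-(P.hamiltonian N x) / T) ∂volume

/-- **Tier P (`LogWindowKickCone`) — the finite-kick L²(Gibbs) cone that is provable NOW**, typed like
the crux: same chain, same Gibbs weight, same zero-friction kernels, same `Function.update` kick with
`s ∈ (0,1]`; window `t ≤ c·d/√(log(2+d))` (almost linear) and tail `(2+d)^{−m}` for EVERY `m`,
uniformly in `N`, bond, contact. NO factor `s²` (the derivative is not capped on the bad event —
Disproof §1–§2: that is exactly the typed crux's unsound content) and no exponential tail. -/
def LogWindowKickCone : Prop :=
  ∀ ω₂ lam β γ : ℝ, 0 < ω₂ → 0 < lam → 0 < β → 0 < γ → ∀ T : ℝ, 0 < T → ∀ m : ℝ, 0 < m →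
    ∃ c C : ℝ, 0 < c ∧
    ∀ (N : ℕ) (i b : Fin N) (t s : ℝ), (b.val = 0 ∨ b.val = N - 1) → 0 ≤ t → 0 < s → s ≤ 1 →
      let P := pinnedChain ω₂ lam β γ
      let P₀ := pinnedChain ω₂ lam β 0
      let μT : Measure (PhaseSpace N) :=
        volume.withDensity (fun x : PhaseSpace N => ENNReal.ofReal (Real.exp (-(P.hamiltonian N x) / T)))
      let d : ℕ := (if b.val = 0 then i.val else N - 2 - i.val)
      t ≤ c * (d : ℝ) / Real.sqrt (Real.log (2 + (d : ℝ))) →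
        ∫ x, ((∫ y, P.bondCurrent N i y ∂(P₀.transitionKernel N T T t.toNNReal (x.1, Function.update x.2 b (x.2 b + s))))
              - (∫ y, P.bondCurrent N i y ∂(P₀.transitionKernel N T T t.toNNReal x))) ^ 2 ∂μT
          ≤ C * ((2 : ℝ) + d) ^ (-m) * ∫ x, Real.exp (-(P.hamiltonian N x) / T) ∂volume

/-- **`LogWindowResampledCone`** — the same bound for card B's THERMAL RESAMPLING of the contact momentum
(`p_b ↦ p' ~ N(0,T)`; both copies exactly Gibbs, kicks of all sizes weighted by the Gaussian): the
object `RepairedWitnessGlue` consumes, at the log-window. -/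
def LogWindowResampledCone : Prop :=
  ∀ ω₂ lam β γ : ℝ, 0 < ω₂ → 0 < lam → 0 < β → 0 < γ → ∀ T : ℝ≥0, 0 < (T : ℝ) → ∀ m : ℝ, 0 < m →
    ∃ c C : ℝ, 0 < c ∧
    ∀ (N : ℕ) (i b : Fin N) (t : ℝ), (b.val = 0 ∨ b.val = N - 1) → 0 ≤ t →
      let P := pinnedChain ω₂ lam β γ
      let P₀ := pinnedChain ω₂ lam β 0
      let μT : Measure (PhaseSpace N) :=
        volume.withDensity (fun x : PhaseSpace N => ENNReal.ofReal (Real.exp (-(P.hamiltonian N x) / T)))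
      let d : ℕ := (if b.val = 0 then i.val else N - 2 - i.val)
      let jt : PhaseSpace N → ℝ := fun x => ∫ y, P.bondCurrent N i y ∂(P₀.transitionKernel N T T t.toNNReal x)
      t ≤ c * (d : ℝ) / Real.sqrt (Real.log (2 + (d : ℝ))) →
        ∫ x, resampleVar N T b jt x ∂μT ≤ C * ((2 : ℝ) + d) ^ (-m) * ∫ x, Real.exp (-(P.hamiltonian N x) / T) ∂volume

/-- Shape of the line for the crux-plan seat (elaboration only): the abstract first lemma, its
instance, the deterministic engine and the master estimate compose to Tier P. (Tier P does NOT imply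
`ClosedConeSensitivity`; it is the provable floor of its repairs — see the card's Transfer field.) -/
def LineP : Prop :=
  StationaryUpcrossingBound → ClosedFlowEnergyExceedance → LogLipschitzTiltInequality →
    ColdBoxMasterEstimate → LogWindowKickCone ∧ LogWindowResampledCone

end Summit.AtomisticToContinuum.FouriersLaw.Cruxes.ClosedConeSensitivity.Ideator3g2
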